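import Mathlib
import Summits.ValiantsHypothesis.ValiantsHypothesis.Theorems.GeneratorObstructionsGenFlipThesisSliceTransfer
import Literature.Computability.AlgebraicComplexity.CharpolyCoeffPowTrace

/-!
# Route GeneratorObstructions — crux `GenFlipThesis` (stmt-ValiantsHypothesis-11653), line
# `slice-overflow`: what `stub_sliceGen` says about the DETERMINANT

Helper file (`--supports stmt-ValiantsHypothesis-11653`).  The determinant `det_m` is an `m`-form in
`m²` variables of polynomial power-trace complexity: Ikenmeyer–Landsberg 2017 Thm. 4.1 / Rem. 4.5
(PROVED in the tree, `IkenmeyerLandsberg2017_powTrace_of_detRepr_holds`) turns its trivial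
determinantal expression of size `m` (`hasDetRepr_detPoly`) into `det_m = tr(A^m)` with `A` of size
`N ≤ (m+1)((m³-m)/3 + 2) - 1 ≤ 6m⁴ < 2^((log₂ m + 3)^3)` (`hasPowTraceRepr_detPoly_window`).  Hence
`det_m` lies in the slice at window exponent `c = 3`, and the uniform bound
`SliceTransfer.genQP_of_sliceGen_of_hasPowTraceRepr` gives:

* `detGenQP_of_sliceGen`: `stub_sliceGen` ⇒ the covariant algebra (algebra of highest-weight
  vectors) of the coordinate ring of the determinant orbit closure `Δ(det_m) ⊆ Sym^m ℂ^{m²}` — the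
  central object of geometric complexity theory — is generated in QUASI-POLYNOMIAL degree:
  `∃ c₀ ∀ m ≥ 1 ∀ χ, γ_χ(det_m) ≠ 0 → -|χ| ≤ m · 2^((log₂ m + c₀)^c₀)`;
* `detGenQP_of_powGenDegreeQP`: the route's crux K2 (`PowGenDegreeQP`) implies the same.

No such generation statement for `ℂ[Δ(det_m)]^U` is in print (BLMW 2011 §§5–6 and the
occurrence/multiplicity literature treat this ring degree by degree); this file only records that the
line's bet CONTAINS it.  Honest framing: implications between open statements; nothing here bears on
`VP ≠ VNP`.

References: Ikenmeyer–Landsberg, J. Pure Appl. Algebra 221 (2017) Thm. 4.1, Rem. 4.5;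
Gesmundo–Ikenmeyer–Panova 2017 §2.2, Prop. 5; Bürgisser–Landsberg–Manivel–Weyman 2011 §5.
-/

namespace Summit.ValiantsHypothesis.ValiantsHypothesis.Theorems.GeneratorObstructions.SliceDet

open MvPolynomial
open Literature.NumberTheory.DiophantineGeometry Literature.Computability.AlgebraicComplexity
  Literature.Barriers.ValiantsHypothesis
open Summit.ValiantsHypothesis.ValiantsHypothesis.Theses.GeneratorObstructions
open Summit.ValiantsHypothesis.ValiantsHypothesis.Theorems.GeneratorObstructions.SliceTransfer

-- `Summit.ValiantsHypothesis.ValiantsHypothesis.…` is the tree's mandated single-conjunct layout.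
set_option linter.dupNamespace false

noncomputable section

/-- Window arithmetic: `6 m⁴ < 2^((log₂ m + 3)^3)` (from `m < 2^(log₂ m + 1)` and
`4L + 7 ≤ (L+3)^3`). [folklore] -/
theorem six_mul_pow_four_lt_window (m : ℕ) : 6 * m ^ 4 < 2 ^ ((Nat.log 2 m + 3) ^ 3) := by
  set L := Nat.log 2 m with hL
  have hm : m < 2 ^ (L + 1) := Nat.lt_pow_succ_log_self one_lt_two m
  have h4 : m ^ 4 < (2 ^ (L + 1)) ^ 4 := Nat.pow_lt_pow_left hm (by norm_num)
  have hexp : 4 * L + 7 ≤ (L + 3) ^ 3 := by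
    have h9 : 9 ≤ (L + 3) ^ 2 := by
      calc 9 = 3 ^ 2 := by norm_num
        _ ≤ (L + 3) ^ 2 := Nat.pow_le_pow_left (by omega) 2
    calc 4 * L + 7 ≤ 9 * (L + 3) := by omega
      _ ≤ (L + 3) ^ 2 * (L + 3) := Nat.mul_le_mul_right _ h9
      _ = (L + 3) ^ 3 := by ring
  calc 6 * m ^ 4 < 8 * (2 ^ (L + 1)) ^ 4 := by
        have : 6 * m ^ 4 ≤ 6 * (2 ^ (L + 1)) ^ 4 := Nat.mul_le_mul_left _ h4.le
        have hpos : 0 < (2 ^ (L + 1)) ^ 4 := by positivity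
        omega
    _ = 2 ^ (4 * L + 7) := by
        rw [← pow_mul, show (8 : ℕ) = 2 ^ 3 by norm_num, ← pow_add]
        congr 1; ring
    _ ≤ 2 ^ ((L + 3) ^ 3) := Nat.pow_le_pow_right (by norm_num) hexp

/-- **`det_m` is a power trace of size `< 2^((log₂ m + 3)^3)`** (`1 ≤ m`): the determinantal
expression `det_m = det(X)` of size `m` (`hasDetRepr_detPoly`) and Ikenmeyer–Landsberg 2017
Thm. 4.1/Rem. 4.5 (tree: `IkenmeyerLandsberg2017_powTrace_of_detRepr_holds`) give `det_m = tr(A^m)`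
with `A` of size `N`, `N + 1 ≤ (m+1)((m³-m)/3+2) ≤ 6m⁴`. [folklore] -/
theorem hasPowTraceRepr_detPoly_window {m : ℕ} (hm : 1 ≤ m) :
    ∃ N : ℕ, N ≤ 2 ^ ((Nat.log 2 m + 3) ^ 3) ∧ HasPowTraceRepr ℂ (detPoly (Fin m) ℂ) m N := by
  have hhom : (detPoly (Fin m) ℂ).IsHomogeneous m := by
    simpa [Fintype.card_fin] using (detPoly_isHomogeneous (n := Fin m) (k := ℂ))
  obtain ⟨N, A, hN, hA1, hAtr⟩ :=
    IkenmeyerLandsberg2017_powTrace_of_detRepr_holds (detPoly (Fin m) ℂ) m m hm hhom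
      (hasDetRepr_detPoly m)
  refine ⟨N, ?_, A, hA1, hAtr⟩
  have h1 : (m ^ 3 - m) / 3 + 2 ≤ m ^ 3 + 2 :=
    Nat.add_le_add_right ((Nat.div_le_self _ _).trans (Nat.sub_le _ _)) 2
  have h2 : (m + 1) * ((m ^ 3 - m) / 3 + 2) ≤ 6 * m ^ 4 := by
    calc (m + 1) * ((m ^ 3 - m) / 3 + 2) ≤ (2 * m) * (3 * m ^ 3) :=
          Nat.mul_le_mul (by omega) (h1.trans (by nlinarith [Nat.one_le_pow 3 m hm]))
      _ = 6 * m ^ 4 := by ring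
  have h3 := six_mul_pow_four_lt_window m
  omega

/-- **`stub_sliceGen` ⇒ the covariant algebra of the determinant orbit closure is generated in
quasi-polynomial degree.**  With the registered `stub_sliceGen` as hypothesis (verbatim): there is
`c₀` such that for every `m ≥ 1` every generator type `χ` of the algebra of highest-weight vectors of
`ℂ[Δ_m(det_m)]` (`det_m` in its own `m²` lexicographic matrix variables, `rename toLex detPoly`) has
degree `-|χ| ≤ m · 2^((log₂ m + c₀)^c₀)`.  Instance `c = 3`, `g = det_m` of
`SliceTransfer.genQP_of_sliceGen_of_hasPowTraceRepr` (`hasPowTraceRepr_detPoly_window`,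
`HasPowTraceRepr.of_le`, `hasPowTraceRepr_rename`). [folklore] -/
theorem detGenQP_of_sliceGen
    (hS : ∀ c : ℕ, ∃ c₀ : ℕ, ∀ m e : ℕ, 1 ≤ m → m + e ≤ 2 ^ ((Nat.log 2 m + c) ^ c) →
      ∀ ι : MatIdx m → MatIdx (m + e), StrictMono ι → IsUpperSet (Set.range ι) →
        ∀ χ : Weight (MatIdx m),
          Module.finrank ℂ (↥(highestWeightSpace (orbitCoordRep (powFormLex ℂ (m + e) m) m) (Function.extend ι χ 0)) ⧸ Submodule.comap (highestWeightSpace (orbitCoordRep (powFormLex ℂ (m + e) m) m) (Function.extend ι χ 0)).subtype (⨆ p : Weight (MatIdx (m + e)) × Weight (MatIdx (m + e)), ⨆ (_ : p.1 + p.2 = (Function.extend ι χ 0) ∧ p.1 ≠ 0 ∧ p.2 ≠ 0), highestWeightSpace (orbitCoordRep (powFormLex ℂ (m + e) m) m) p.1 * highestWeightSpace (orbitCoordRep (powFormLex ℂ (m + e) m) m) p.2)) ≠ 0 →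
            -(Weight.size χ) ≤ (m : ℤ) * 2 ^ ((Nat.log 2 m + c₀) ^ c₀)) :
    ∃ c₀ : ℕ, ∀ m : ℕ, 1 ≤ m → ∀ χ : Weight (MatIdx m),
      Module.finrank ℂ (↥(highestWeightSpace (orbitCoordRep (rename toLex (detPoly (Fin m) ℂ) : MvPolynomial (MatIdx m) ℂ) m) χ) ⧸ Submodule.comap (highestWeightSpace (orbitCoordRep (rename toLex (detPoly (Fin m) ℂ) : MvPolynomial (MatIdx m) ℂ) m) χ).subtype (⨆ p : Weight (MatIdx m) × Weight (MatIdx m), ⨆ (_ : p.1 + p.2 = χ ∧ p.1 ≠ 0 ∧ p.2 ≠ 0), highestWeightSpace (orbitCoordRep (rename toLex (detPoly (Fin m) ℂ) : MvPolynomial (MatIdx m) ℂ) m) p.1 * highestWeightSpace (orbitCoordRep (rename toLex (detPoly (Fin m) ℂ) : MvPolynomial (MatIdx m) ℂ) m) p.2)) ≠ 0 →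
        -(Weight.size χ) ≤ (m : ℤ) * 2 ^ ((Nat.log 2 m + c₀) ^ c₀) := by
  obtain ⟨c₀, hc₀⟩ := genQP_of_sliceGen_of_hasPowTraceRepr hS 3
  refine ⟨c₀, fun m hm χ hγ => ?_⟩
  obtain ⟨N, hN, hrep⟩ := hasPowTraceRepr_detPoly_window hm
  have hmwin : m ≤ 2 ^ ((Nat.log 2 m + 3) ^ 3) := by
    have h := six_mul_pow_four_lt_window m
    nlinarith [Nat.one_le_pow 3 m hm]
  -- pad the representation to size `max N m = m + e`
  set e := max N m - m with he
  have hsize : max N m = m + e := by omega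
  have hrep' : HasPowTraceRepr ℂ (rename toLex (detPoly (Fin m) ℂ) : MvPolynomial (MatIdx m) ℂ) m (m + e) := by
    rw [← hsize]
    exact HasPowTraceRepr.of_le hm (le_max_left N m) (hasPowTraceRepr_rename hrep toLex)
  have hwin : m + e ≤ 2 ^ ((Nat.log 2 m + 3) ^ 3) := by
    rw [← hsize]; exact max_le hN hmwin
  have hhom : (rename toLex (detPoly (Fin m) ℂ) : MvPolynomial (MatIdx m) ℂ).IsHomogeneous m := by
    simpa [Fintype.card_fin] using
      (detPoly_isHomogeneous (n := Fin m) (k := ℂ)).rename_isHomogeneous (f := (toLex : Fin m × Fin m → MatIdx m))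
  have hne : (rename toLex (detPoly (Fin m) ℂ) : MvPolynomial (MatIdx m) ℂ) ≠ 0 :=
    (map_ne_zero_iff _ (rename_injective _ toLex.injective)).mpr
      (Matrix.det_mvPolynomialX_ne_zero (Fin m) ℂ)
  exact hc₀ m e hm hwin _ hhom hne hrep' χ hγ

/-- **K2 ⇒ the same**: the route's crux `PowGenDegreeQP` (stmt-ValiantsHypothesis-11655) already
asserts quasi-polynomial generation of the covariant algebra of `Δ(det_m)`
(`sliceGen_of_powGenDegreeQP`). [folklore] -/
theorem detGenQP_of_powGenDegreeQP (hK2 : PowGenDegreeQP) :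
    ∃ c₀ : ℕ, ∀ m : ℕ, 1 ≤ m → ∀ χ : Weight (MatIdx m),
      Module.finrank ℂ (↥(highestWeightSpace (orbitCoordRep (rename toLex (detPoly (Fin m) ℂ) : MvPolynomial (MatIdx m) ℂ) m) χ) ⧸ Submodule.comap (highestWeightSpace (orbitCoordRep (rename toLex (detPoly (Fin m) ℂ) : MvPolynomial (MatIdx m) ℂ) m) χ).subtype (⨆ p : Weight (MatIdx m) × Weight (MatIdx m), ⨆ (_ : p.1 + p.2 = χ ∧ p.1 ≠ 0 ∧ p.2 ≠ 0), highestWeightSpace (orbitCoordRep (rename toLex (detPoly (Fin m) ℂ) : MvPolynomial (MatIdx m) ℂ) m) p.1 * highestWeightSpace (orbitCoordRep (rename toLex (detPoly (Fin m) ℂ) : MvPolynomial (MatIdx m) ℂ) m) p.2)) ≠ 0 →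
        -(Weight.size χ) ≤ (m : ℤ) * 2 ^ ((Nat.log 2 m + c₀) ^ c₀) :=
  detGenQP_of_sliceGen (sliceGen_of_powGenDegreeQP hK2)

end

end Summit.ValiantsHypothesis.ValiantsHypothesis.Theorems.GeneratorObstructions.SliceDet
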